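import Literature.Probability.RandomPlanarGeometry.HexSAWBrickWallWalks
import HarnessLib

/-!
# Bridges of the honeycomb lattice in the brick-wall frame: concatenation, `b_m b_n ≤ b_{m+n}`, `b_n ≤ μ_ℍ^n`

Topic `Literature/Probability/RandomPlanarGeometry` (lane «pcv-sawmu», route R76 «HEX-BRIDGE-RATIO-2»;
continues `HexSAWBrickWallWalks.lean`, whose vocabulary `HexBW.saws`, `HexBW.bridges`,
`HexBW.bridgeCount = b_n(ℍ)`, `HexBW.twistAt` it uses). Source: N. Madras, G. Slade, *The Self-Avoiding
Walk* (1993), Definition 1.2.4 and eq. (1.2.15), p. 11 (bridges; "the concatenation of two bridges will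
always yield another bridge", `b_m b_n ≤ b_{m+n}`), eq. (1.2.17) (`b_N ≤ μ_{Bridge}^N ≤ μ^N`).

The concatenation map of the tree's `ℤ^d` file `SAWBridges.lean` (`Zd.concatWalk`) is reused verbatim on
`HexBW.saws n ⊆ Zd.saws 2 n`, the second walk being post-composed with the parity twist `HexBW.twistAt p`
of `HexSAWBrickWallWalks.lean` (a translate of a brick-wall walk by an odd site is not a brick-wall walk,
its twist is; the twist does not touch heights). Status in print: (1.2.15) and (1.2.17) are printed for
`ℤ^d`; the honeycomb instances are folklore, first written and kernel-checked here; no novelty claimed.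

## Contents (namespace `Literature.Probability.RandomPlanarGeometry.SAW.HexBW`; all PROVED, axioms standard)

* `twistAt_comp_mem_zdSaws`, `isBridge_twistAt_comp_iff`, `isHalfSpace_twistAt_comp_iff`,
  `adj_add_twistAt_iff`, `straightWalk_mem_bridges`;
* `concat`, `concat_mem_bridges`, **`bridgeCount_mul_le : b_m b_n ≤ b_{m+n}`**, `bridgeCount_pow_le`,
  **`bridgeCount_le_add : b_n ≤ b_{n+k}`** (in particular `b_n ≤ b_{n+2}`);
* **`bridgeCount_le_pow : b_n(ℍ) ≤ μ_ℍ^n`**.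
-/

noncomputable section

open Finset Filter Topology Literature.Probability.LatticeModels SimpleGraph
open scoped BigOperators

namespace Literature.Probability.RandomPlanarGeometry.SAW

namespace HexBW

/-! ### The parity twist on walks -/

/-- `z ↦ p + twistAt p z` carries brick-wall bonds to brick-wall bonds (`adj_twistAt_add_iff` with the
sum commuted). [cite: EntingJensen2009, §7.4.2, Fig. 7.10 (brickwork form of the honeycomb lattice)] -/
theorem adj_add_twistAt_iff (p x y : Site 2) :
    brickWallGraph.Adj (p + twistAt p x) (p + twistAt p y) ↔ brickWallGraph.Adj x y := by
  rw [add_comm p, add_comm p]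
  exact adj_twistAt_add_iff p x y

/-- Post-composition with `twistAt p` preserves the `ℤ²` walks from `0` (lattice symmetry).
[cite: MadrasSlade1993, §1.2] -/
theorem twistAt_comp_mem_zdSaws {n : ℕ} {ω : ℕ → Site 2} (p : Site 2) (hω : ω ∈ Zd.saws 2 n) :
    (fun i => twistAt p (ω i)) ∈ Zd.saws 2 n := by
  obtain ⟨h0, hend, hadj, hinj⟩ := Zd.mem_saws.1 hω
  refine Zd.mem_saws.2 ⟨by simp [h0], fun i hi => by simp [hend i hi], fun i hi =>
    (zd_adj_twistAt_iff p _ _).2 (hadj i hi), fun i hi j hj hij => hinj hi hj (twistAt_injective p hij)⟩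

/-- Post-composition with `twistAt p` does not change bridge-ness (heights are untouched).
[cite: MadrasSlade1993, Definition 1.2.4] -/
theorem isBridge_twistAt_comp_iff {n : ℕ} {ω : ℕ → Site 2} (p : Site 2) :
    Zd.IsBridge n (fun i => twistAt p (ω i)) ↔ Zd.IsBridge n ω := by
  simp only [Zd.IsBridge, twistAt_apply_zero]

/-- Post-composition with `twistAt p` does not change half-space-ness (heights are untouched).
[cite: MadrasSlade1993, Definition 3.1.2] -/
theorem isHalfSpace_twistAt_comp_iff {n : ℕ} {ω : ℕ → Site 2} (p : Site 2) :
    Zd.IsHalfSpace n (fun i => twistAt p (ω i)) ↔ Zd.IsHalfSpace n ω := by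
  simp only [Zd.IsHalfSpace, twistAt_apply_zero]

/-- The straight horizontal walk is a bridge. [cite: MadrasSlade1993, §1.2] -/
theorem straightWalk_mem_bridges (n : ℕ) : Zd.straightWalk 2 n ∈ bridges n := by
  refine mem_bridges.2 ⟨straightWalk_mem n, fun i h1 h2 => ?_⟩
  simp only [Zd.straightWalk, Pi.single_eq_same, min_eq_left h2, min_self, Nat.zero_min, Nat.cast_zero]
  exact ⟨by exact_mod_cast h1, by exact_mod_cast h2⟩

/-! ### Concatenation with the parity twist: `b_m b_n ≤ b_{m+n}` (Madras–Slade (1.2.15)) -/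

/-- Concatenation of an `m`-step brick-wall walk with the twisted translate of a second walk: the second
walk is parity-twisted according to the endpoint `ω m` before being translated there.
[cite: MadrasSlade1993, §1.2, eq. (1.2.15)] -/
def concat (m : ℕ) (ω υ : ℕ → Site 2) : ℕ → Site 2 :=
  Zd.concatWalk m ω fun j => twistAt (ω m) (υ j)

/-- The twisted concatenation of two brick-wall bridges is a brick-wall bridge.
[cite: MadrasSlade1993, §1.2, eq. (1.2.15)] -/
theorem concat_mem_bridges {m n : ℕ} {ω υ : ℕ → Site 2} (hω : ω ∈ bridges m) (hυ : υ ∈ bridges n) :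
    concat m ω υ ∈ bridges (m + n) := by
  obtain ⟨hωS, hωb⟩ := mem_bridges.1 hω
  obtain ⟨hυS, hυb⟩ := mem_bridges.1 hυ
  obtain ⟨hωZ, hωst⟩ := mem_saws.1 hωS
  obtain ⟨hυZ, hυst⟩ := mem_saws.1 hυS
  set p : Site 2 := ω m with hp
  set υ' : ℕ → Site 2 := fun j => twistAt p (υ j) with hυ'
  have hυ'Z : υ' ∈ Zd.saws 2 n := twistAt_comp_mem_zdSaws p hυZ
  have hυ'b : Zd.IsBridge n υ' := (isBridge_twistAt_comp_iff p).2 hυb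
  have hω0 := (Zd.mem_saws.1 hωZ).1
  have hυ0 := (Zd.mem_saws.1 hυZ).1
  have hυ'0 : υ' 0 = 0 := (Zd.mem_saws.1 hυ'Z).1
  have h00 : (0 : Site 2) 0 = 0 := rfl
  -- heights: `ω i 0 ≤ ω m 0` on `[0, m]`, `ω m 0 < (ω m + υ' j) 0` for `1 ≤ j ≤ n`
  have hle : ∀ i ≤ m, ω i 0 ≤ ω m 0 := by
    intro i hi
    rcases Nat.eq_zero_or_pos i with rfl | hpos
    · rcases Nat.eq_zero_or_pos m with rfl | hm
      · exact le_rfl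
      · exact (hωb m hm le_rfl).1.le
    · exact (hωb i hpos hi).2
  have hgt : ∀ j, 1 ≤ j → j ≤ n → ω m 0 < (ω m + υ' j) 0 := by
    intro j h1 h2
    have := (hυ'b j h1 h2).1
    rw [hυ'0, h00] at this
    simp only [Pi.add_apply]
    linarith
  have hZ : concat m ω υ ∈ Zd.saws 2 (m + n) := by
    refine Zd.concatWalk_mem_saws hωZ hυ'Z fun i hi j h1 h2 heq => ?_
    have ha := hle i hi
    have hb := hgt j h1 h2
    rw [← heq] at hb
    linarith
  refine mem_bridges.2 ⟨mem_saws.2 ⟨hZ, fun i hi => ?_⟩, fun i h1 h2 => ?_⟩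
  · -- brick-wall steps
    by_cases h : i + 1 ≤ m
    · simp only [concat, Zd.concatWalk, if_pos h, if_pos (Nat.le_of_succ_le h)]
      exact hωst i (by omega)
    · by_cases h' : i ≤ m
      · have him : i = m := by omega
        subst him
        simp only [concat, Zd.concatWalk, if_pos le_rfl, if_neg h, Nat.add_sub_cancel_left]
        have key := (adj_add_twistAt_iff (ω i) (υ 0) (υ 1)).2 (hυst 0 (by omega))
        rwa [hυ0, twistAt_zero, add_zero] at key
      · simp only [concat, Zd.concatWalk, if_neg h, if_neg h', show i + 1 - m = (i - m) + 1 by omega]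
        exact (adj_add_twistAt_iff (ω m) _ _).2 (hυst (i - m) (by omega))
  · -- bridge heights
    have hstart : concat m ω υ 0 = 0 := by simp [concat, Zd.concatWalk, hω0]
    have hlast : concat m ω υ (m + n) 0 = ω m 0 + υ' n 0 := by
      by_cases h : m + n ≤ m
      · have hn : n = 0 := by omega
        subst hn
        simp [concat, Zd.concatWalk, hυ', hυ0]
      · simp [concat, Zd.concatWalk, h, hυ']
    have hυ'n : 0 ≤ υ' n 0 := by
      rcases Nat.eq_zero_or_pos n with rfl | hn
      · rw [hυ'0, h00]
      · have := (hυ'b n hn le_rfl).1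
        rw [hυ'0, h00] at this
        exact this.le
    rw [hstart, hlast, h00]
    by_cases h : i ≤ m
    · simp only [concat, Zd.concatWalk, if_pos h]
      have := (hωb i h1 h).1
      rw [hω0, h00] at this
      exact ⟨this, (hle i h).trans (by linarith)⟩
    · simp only [concat, Zd.concatWalk, if_neg h, Pi.add_apply]
      have := hυ'b (i - m) (by omega) (by omega)
      rw [hυ'0, h00] at this
      have hm0 : 0 ≤ ω m 0 := by have := hle 0 (Nat.zero_le m); rwa [hω0] at this
      refine ⟨by simp only [hυ'] at this ⊢; linarith [this.1], ?_⟩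
      simp only [hυ'] at this ⊢
      linarith [this.2]

/-- **`b_m · b_n ≤ b_{m+n}` for the honeycomb lattice**: "the concatenation of two bridges will always
yield another bridge", with the parity twist. [cite: MadrasSlade1993, §1.2, eq. (1.2.15)] -/
theorem bridgeCount_mul_le (m n : ℕ) : bridgeCount m * bridgeCount n ≤ bridgeCount (m + n) := by
  rw [bridgeCount, bridgeCount, bridgeCount, ← Finset.card_product]
  refine Finset.card_le_card_of_injOn (fun q => concat m q.1 q.2) ?_ ?_
  · rintro ⟨ω, υ⟩ hq
    simp only [Finset.mem_coe, Finset.mem_product] at hq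
    exact concat_mem_bridges hq.1 hq.2
  · rintro ⟨ω, υ⟩ hq ⟨ω', υ'⟩ hq' h
    simp only [Finset.mem_coe, Finset.mem_product, mem_bridges, mem_saws] at hq hq'
    dsimp only at h
    have hω := Zd.mem_saws.1 hq.1.1.1
    have hυ := Zd.mem_saws.1 hq.2.1.1
    have hω' := Zd.mem_saws.1 hq'.1.1.1
    have hυ' := Zd.mem_saws.1 hq'.2.1.1
    have h1 : ω = ω' := by
      funext i
      rcases le_or_gt i m with hi | hi
      · have := congrFun h i
        simpa [concat, Zd.concatWalk, hi] using this
      · rw [hω.2.1 i hi.le, hω'.2.1 i hi.le]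
        have := congrFun h m
        simpa [concat, Zd.concatWalk] using this
    subst h1
    simp only [Prod.mk.injEq, true_and]
    funext j
    rcases Nat.eq_zero_or_pos j with rfl | hj
    · rw [hυ.1, hυ'.1]
    · have := congrFun h (m + j)
      simp only [concat, Zd.concatWalk, Nat.not_le.2 (by omega : m < m + j), if_false,
        Nat.add_sub_cancel_left, add_right_inj] at this
      exact twistAt_injective _ this

/-- `b_n(ℍ)ᵏ ≤ b_{kn}(ℍ)`: concatenate `k` bridges. [cite: MadrasSlade1993, §1.2, eq. (1.2.15)] -/
theorem bridgeCount_pow_le (n k : ℕ) : bridgeCount n ^ k ≤ bridgeCount (k * n) := by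
  induction k with
  | zero => simpa using one_le_bridgeCount 0
  | succ k ih =>
    calc bridgeCount n ^ (k + 1) = bridgeCount n ^ k * bridgeCount n := pow_succ _ _
      _ ≤ bridgeCount (k * n) * bridgeCount n := Nat.mul_le_mul_right _ ih
      _ ≤ bridgeCount (k * n + n) := bridgeCount_mul_le _ _
      _ = bridgeCount ((k + 1) * n) := by rw [Nat.succ_mul]

/-- **`b_n(ℍ) ≤ b_{n+k}(ℍ)`** (append a straight bridge: `b_n · 1 ≤ b_n b_k ≤ b_{n+k}`); in particular
`b_n ≤ b_{n+2}`, the monotonicity input of the two-step ratio theorem for bridges.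
[cite: MadrasSlade1993, §1.2, eq. (1.2.15)] -/
theorem bridgeCount_le_add (n k : ℕ) : bridgeCount n ≤ bridgeCount (n + k) :=
  calc bridgeCount n = bridgeCount n * 1 := (mul_one _).symm
    _ ≤ bridgeCount n * bridgeCount k := Nat.mul_le_mul_left _ (one_le_bridgeCount k)
    _ ≤ bridgeCount (n + k) := bridgeCount_mul_le n k

/-! ### `b_n ≤ μ_ℍ^n` (Madras–Slade (1.2.17)) -/

/-- **`b_n(ℍ) ≤ μ_ℍ^n`** ("`b_N ≤ μ_{Bridge}^N ≤ μ^N`"): from `b_nᵏ ≤ b_{kn} ≤ c_{kn}` and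
`c_m(ℍ)^{1/m} → μ_ℍ`. [cite: MadrasSlade1993, §1.2, eq. (1.2.17)] -/
theorem bridgeCount_le_pow (n : ℕ) : (bridgeCount n : ℝ) ≤ hexConnectiveConstant ^ n := by
  rcases Nat.eq_zero_or_pos n with rfl | hn
  · simp [bridgeCount_zero]
  have hsub : Tendsto (fun k : ℕ => k * n) atTop atTop := tendsto_id.atTop_mul_const' hn
  have hlim : Tendsto (fun k : ℕ => ((hexSawCount (k * n) : ℝ) ^ (1 / ((k * n : ℕ) : ℝ))) ^ n) atTop
      (𝓝 (hexConnectiveConstant ^ n)) :=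
    (tendsto_hexSawCount_rpow.comp hsub).pow n
  refine ge_of_tendsto hlim ?_
  filter_upwards [eventually_ge_atTop 1] with k hk
  have hkn : (k * n : ℕ) ≠ 0 := Nat.mul_ne_zero (by omega) hn.ne'
  have hb0 : (0 : ℝ) ≤ bridgeCount n := Nat.cast_nonneg _
  have hc0 : (0 : ℝ) ≤ hexSawCount (k * n) := Nat.cast_nonneg _
  have hpow : ((bridgeCount n : ℝ)) ^ (k * n) ≤
      (((hexSawCount (k * n) : ℝ) ^ (1 / ((k * n : ℕ) : ℝ))) ^ n) ^ (k * n) := by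
    have h1 : ((bridgeCount n : ℝ)) ^ (k * n) = ((bridgeCount n : ℝ) ^ k) ^ n := by rw [← pow_mul]
    have h2 : (((hexSawCount (k * n) : ℝ) ^ (1 / ((k * n : ℕ) : ℝ))) ^ n) ^ (k * n) =
        (hexSawCount (k * n) : ℝ) ^ n := by
      rw [← pow_mul, mul_comm n (k * n), pow_mul, one_div, Real.rpow_inv_natCast_pow hc0 hkn]
    rw [h1, h2]
    refine pow_le_pow_left₀ (pow_nonneg hb0 _) ?_ n
    exact_mod_cast (bridgeCount_pow_le n k).trans (bridgeCount_le (k * n))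
  exact le_of_pow_le_pow_left₀ hkn (pow_nonneg (Real.rpow_nonneg hc0 _) _) hpow

end HexBW

end Literature.Probability.RandomPlanarGeometry.SAW
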